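import Literature.MathematicalPhysics.QuantumLattice.HubbardBondAlgebra
import Literature.MathematicalPhysics.QuantumLattice.HubbardFermiLiquid
import Literature.MathematicalPhysics.QuantumLattice.DuhamelTwoPointProofs
import HarnessLib

/-!
# The Hubbard two-point function as the logarithmic derivative of a source-inserted partition function

Programme under the named fact `bgm_two_point_limit` (`HubbardFermiLiquid.lean`;
Benfatto–Giuliani–Mastropietro 2006, Thm. 1.1), high-temperature corner via the polymer expansion
of Ueltschi (1999). In the proof of his Theorem 2.1 (ii) (arXiv p. 5: "The expectation value of
`K` involves the quantity `Tr K e^{-βH_Λ}`, that we expand as before …") the expectation of a local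
observable `K` is obtained from the SAME expansion as the partition function, with `K` inserted.
For the observable of the fact — the hopping/bond operator `T_{b₀} = c†_{xσ} c_{yσ}`,
`b₀ = (x, y, σ)` — the insertion is a SOURCE TERM in the exponent: with the generalised Gibbs
factor `Zc(β, U, μ; c) = Tr exp(-βV + Σ_b c_b T_b)` of `HubbardBondAlgebra` (arbitrary complex
coupling on every bond),

  `⟨c†_{xσ} c_{yσ}⟩_{β, H_G(t,U) - μN} = ∂_ε Zc(βt·1_{bonds G} + ε δ_{b₀}) |_{ε=0} / Zc(βt·1_{bonds G})`

(`thermalCorr_creation_annihilation_eq_deriv_div`; for the torus two-point function of the fact,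
`hubbardThermalTwoPoint_eq_deriv_div`), because `d/dε Tr e^{A + εT} = Tr(T e^{A + εT})` (Duhamel's
formula and cyclicity of the trace). This puts the two-point function inside the reach of the
general-coupling polymer expansion (`HubbardCouplingWeights.lean`: the coupling function
`βt·1_{bonds} + ε δ_{b₀}` on the active bond set `bonds ∪ {b₀}`). PROVED here:

* `Matrix.exp_add_smul_sub_complex`, `Matrix.hasDerivAt_exp_add_smul_complex`,
  `Matrix.hasDerivAt_trace_exp_add_smul_complex` — the COMPLEX-parameter versions of the
  derivative of `ε ↦ e^{A + εY}` and `d/dε Tr e^{A+εY} = Tr(Y e^{A+εY})` (the tree's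
  `DuhamelTwoPointProofs` has the real-parameter versions; the proofs are the same, from the
  parameter-free Duhamel formula `Matrix.exp_add_eq_exp_add_integral`);
* `hopSum_smul_single`, `Zc_add_smul_single` (`Zc(c + ε δ_{b₀}) = Tr exp(-βV + Σ c T + ε T_{b₀})`),
  `hasDerivAt_Zc_add_smul_single`, `differentiable_Zc_add_smul_single` (entire in `ε`),
  `deriv_Zc_add_smul_single_zero`;
* `gibbsWeight_hamiltonianWith_eq_exp` (`e^{-β(H_G(t,U) - μN)} = exp(-βV + Σ_{bonds G} βt T_b)`),
  `thermalCorr_creation_annihilation_eq_deriv_div`, `hubbardThermalTwoPoint_eq_deriv_div`;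
* `deriv_eq_deriv_div_of_exp_mul_eq` — the calculus identity turning this into a statement about
  any differentiable LOGARITHM `F` of `ε ↦ Zc(… + εδ_{b₀})/κ` near `0` (such as the Kotecký–Preiss
  branch `polymerLogZ` of the cluster expansion): `F'(0) = Zc'(0)/Zc(0) = ⟨T_{b₀}⟩`.

## Mathlib / tree search

Tree: `Matrix.exp_add_eq_exp_add_integral`, `Matrix.continuous_exp_smul_mul_mul_exp`,
`Matrix.hasDerivAt_trace_exp_add_smul` (real parameter; `DuhamelTwoPointProofs`), `Zc`, `hopSum`,
`hopSum_add`, `bondOp`, `hubbardCoupling`, `hopSum_hubbardCoupling`, `onSiteSum_univ`,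
`partitionFn_hamiltonianWith_eq_Zc` (`HubbardBondAlgebra`), `hamiltonianWith_eq_hoppingForm_add_diagonal`
(`HubbardAtomicLimit`), `thermalCorr`, `gibbsState_apply` (`FinDimSpectrum`), `hubbardThermalTwoPoint`
(`HubbardFermiLiquid`). Mathlib: `hasDerivAt_iff_tendsto_slope_zero`,
`intervalIntegral.continuous_parametric_intervalIntegral_of_continuous'`,
`ContinuousLinearMap.intervalIntegral_comp_comm`, `Complex.hasDerivAt_exp`.

## References

* D. Ueltschi, J. Stat. Phys. 95 (1999) 693 (arXiv:cond-mat/9810320), proof of Thm. 2.1 (ii),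
  p. 5 (expectation values of local operators from the expansion with `K` inserted). [Ueltschi1999]
* F. J. Dyson, E. H. Lieb, B. Simon, J. Stat. Phys. 18 (1978) 335, eq. (5) (Duhamel's formula),
  §3 (`d/dh Tr e^{A+hB} = Tr(B e^{A+hB})`). [DLS1978]
* G. Benfatto, A. Giuliani, V. Mastropietro, Ann. Henri Poincaré 7 (2006) 809, §1.2 (1.2) (the
  two-point Schwinger function). [BenfattoGiulianiMastropietro2006]
-/

noncomputable section

open scoped Matrix.Norms.L2Operator
open Finset MeasureTheory intervalIntegral Filter NormedSpace

/-! ### Complex-parameter Duhamel derivative of the matrix exponential -/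

namespace Matrix

variable {m : Type*} [Fintype m] [DecidableEq m]

/-- The increment of `ε ↦ e^{A+εY}` for a COMPLEX parameter:
`e^{A+(ε₀+ε)Y} - e^{A+ε₀Y} = ε ∫₀¹ e^{s(A+(ε₀+ε)Y)} Y e^{(1-s)(A+ε₀Y)} ds`. [cite: DLS1978, eq. (5)] -/
theorem exp_add_smul_sub_complex (A Y : Matrix m m ℂ) (ε₀ ε : ℂ) :
    exp (A + (ε₀ + ε) • Y) - exp (A + ε₀ • Y) =
      ε • ∫ s in (0:ℝ)..1, exp (s • (A + (ε₀ + ε) • Y)) * Y * exp ((1 - s) • (A + ε₀ • Y)) := by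
  have h := exp_add_eq_exp_add_integral (A + ε₀ • Y) (ε • Y)
  have e : A + ε₀ • Y + ε • Y = A + (ε₀ + ε) • Y := by rw [add_smul, add_assoc]
  rw [e] at h
  rw [h, add_sub_cancel_left, ← intervalIntegral.integral_smul]
  congr 1
  funext s
  rw [mul_smul_comm, smul_mul_assoc]

/-- The complex difference quotient of `ε ↦ e^{A+εY}` at `ε₀` is a parametric integral, continuous
in the increment. [folklore] -/
theorem continuous_duhamel_increment_complex (A Y Z : Matrix m m ℂ) (ε₀ : ℂ) :
    Continuous fun ε : ℂ =>
      ∫ s in (0:ℝ)..1, exp (s • (A + (ε₀ + ε) • Y)) * Y * exp ((1 - s) • Z) := by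
  letI : NormedAlgebra ℚ (Matrix m m ℂ) := .restrictScalars ℚ ℂ _
  refine intervalIntegral.continuous_parametric_intervalIntegral_of_continuous' ?_ 0 1
  show Continuous fun p : ℂ × ℝ => exp (p.2 • (A + (ε₀ + p.1) • Y)) * Y * exp ((1 - p.2) • Z)
  fun_prop

/-- **The complex derivative of `ε ↦ e^{A+εY}`**:
`d/dε e^{A+εY} = ∫₀¹ e^{s(A+εY)} Y e^{(1-s)(A+εY)} ds` at every `ε₀ ∈ ℂ`. [cite: DLS1978, eq. (5)] -/
theorem hasDerivAt_exp_add_smul_complex (A Y : Matrix m m ℂ) (ε₀ : ℂ) :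
    HasDerivAt (fun ε : ℂ => exp (A + ε • Y))
      (∫ s in (0:ℝ)..1, exp (s • (A + ε₀ • Y)) * Y * exp ((1 - s) • (A + ε₀ • Y))) ε₀ := by
  rw [hasDerivAt_iff_tendsto_slope_zero]
  set G : ℂ → Matrix m m ℂ := fun ε =>
    ∫ s in (0:ℝ)..1, exp (s • (A + (ε₀ + ε) • Y)) * Y * exp ((1 - s) • (A + ε₀ • Y)) with hG
  have hGc : Continuous G := continuous_duhamel_increment_complex A Y (A + ε₀ • Y) ε₀
  have hG0 : G 0 = ∫ s in (0:ℝ)..1, exp (s • (A + ε₀ • Y)) * Y * exp ((1 - s) • (A + ε₀ • Y)) := by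
    simp only [hG, add_zero]
  rw [← hG0]
  refine ((hGc.tendsto 0).mono_left nhdsWithin_le_nhds).congr' ?_
  refine eventually_nhdsWithin_of_forall fun ε hε => ?_
  show G ε = ε⁻¹ • (exp (A + (ε₀ + ε) • Y) - exp (A + ε₀ • Y))
  rw [exp_add_smul_sub_complex, inv_smul_smul₀ hε]

/-- **`d/dε Tr e^{A+εY} = Tr(Y e^{A+εY})` for a complex parameter** (cyclicity of the trace
collapses the Duhamel integral). [cite: DLS1978, §3] -/
theorem hasDerivAt_trace_exp_add_smul_complex (A Y : Matrix m m ℂ) (ε₀ : ℂ) :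
    HasDerivAt (fun ε : ℂ => (exp (A + ε • Y)).trace) ((Y * exp (A + ε₀ • Y)).trace) ε₀ := by
  set L : Matrix m m ℂ →L[ℂ] ℂ := LinearMap.toContinuousLinearMap (Matrix.traceLinearMap m ℂ ℂ) with hL
  have hLapply : ∀ X : Matrix m m ℂ, L X = X.trace := fun X => rfl
  have h := L.hasFDerivAt.comp_hasDerivAt ε₀ (hasDerivAt_exp_add_smul_complex A Y ε₀)
  rw [← L.intervalIntegral_comp_comm
    ((continuous_exp_smul_mul_mul_exp _ Y _).intervalIntegrable 0 1)] at h
  simp only [hLapply] at h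
  refine h.congr_deriv ?_
  have key : ∀ s : ℝ, (exp (s • (A + ε₀ • Y)) * Y * exp ((1 - s) • (A + ε₀ • Y))).trace =
      (Y * exp (A + ε₀ • Y)).trace := by
    intro s
    have hc : Commute ((1 - s) • (A + ε₀ • Y)) (s • (A + ε₀ • Y)) :=
      ((Commute.refl (A + ε₀ • Y)).smul_left _).smul_right _
    rw [Matrix.mul_assoc, trace_mul_comm, Matrix.mul_assoc, ← Matrix.exp_add_of_commute _ _ hc,
      ← add_smul, sub_add_cancel, one_smul]
  simp_rw [key]
  simp

end Matrix

/-! ### The source-inserted Gibbs factor and its derivative -/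

namespace Literature.MathematicalPhysics.QuantumLattice

open Matrix HubbardWave0 Literature.Probability.LatticeModels
open scoped _root_.Topology

section Source

variable {Λ : Type*} [LinearOrder Λ] [Fintype Λ]

/-- The hopping operator of a coupling concentrated on one bond: `hopSum (ε δ_{b₀}) = ε T_{b₀}`.
[folklore] -/
theorem hopSum_smul_single (ε : ℂ) (b₀ : Bond Λ) :
    hopSum (ε • (Pi.single b₀ 1 : Bond Λ → ℂ)) = ε • bondOp b₀ := by
  rw [hopSum, Finset.sum_eq_single b₀]
  · rw [Pi.smul_apply, Pi.single_eq_same, smul_eq_mul, mul_one]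
  · intro b _ hb
    rw [Pi.smul_apply, Pi.single_eq_of_ne hb, smul_zero, zero_smul]
  · intro h
    exact absurd (Finset.mem_univ _) h

/-- **The source-inserted Gibbs factor**: `Zc(c + ε δ_{b₀}) = Tr exp(-βV_Λ + Σ_b c_b T_b + ε T_{b₀})`.
[cite: Ueltschi1999, proof of Thm. 2.1 (ii) (Tr K e^{-βH_Λ}, expanded as before)] -/
theorem Zc_add_smul_single (β U μ : ℂ) (c : Bond Λ → ℂ) (b₀ : Bond Λ) (ε : ℂ) :
    Zc β U μ (c + ε • (Pi.single b₀ 1 : Bond Λ → ℂ)) =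
      (NormedSpace.exp ((-(β • onSiteSum U μ (Finset.univ : Finset Λ)) + hopSum c) + ε • bondOp b₀)).trace := by
  rw [Zc, hopSum_add, hopSum_smul_single, add_assoc]

/-- **The derivative in the source**: `d/dε Zc(c + ε δ_{b₀}) = Tr(T_{b₀} exp(-βV + Σ c T + ε T_{b₀}))`
at every complex `ε₀`. [cite: DLS1978, §3] -/
theorem hasDerivAt_Zc_add_smul_single (β U μ : ℂ) (c : Bond Λ → ℂ) (b₀ : Bond Λ) (ε₀ : ℂ) :
    HasDerivAt (fun ε : ℂ => Zc β U μ (c + ε • (Pi.single b₀ 1 : Bond Λ → ℂ)))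
      ((bondOp b₀ * NormedSpace.exp ((-(β • onSiteSum U μ (Finset.univ : Finset Λ)) + hopSum c) +
        ε₀ • bondOp b₀)).trace) ε₀ := by
  have h := Matrix.hasDerivAt_trace_exp_add_smul_complex
    (-(β • onSiteSum U μ (Finset.univ : Finset Λ)) + hopSum c) (bondOp b₀) ε₀
  refine h.congr_of_eventuallyEq (Eventually.of_forall fun ε => ?_)
  exact Zc_add_smul_single β U μ c b₀ ε

/-- The source-inserted Gibbs factor is an entire function of the source strength. [folklore] -/
theorem differentiable_Zc_add_smul_single (β U μ : ℂ) (c : Bond Λ → ℂ) (b₀ : Bond Λ) :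
    Differentiable ℂ fun ε : ℂ => Zc β U μ (c + ε • (Pi.single b₀ 1 : Bond Λ → ℂ)) :=
  fun ε => (hasDerivAt_Zc_add_smul_single β U μ c b₀ ε).differentiableAt

/-- At `ε = 0`: `d/dε Zc(c + ε δ_{b₀})|₀ = Tr(exp(-βV + Σ c T) T_{b₀})`. [cite: DLS1978, §3] -/
theorem deriv_Zc_add_smul_single_zero (β U μ : ℂ) (c : Bond Λ → ℂ) (b₀ : Bond Λ) :
    deriv (fun ε : ℂ => Zc β U μ (c + ε • (Pi.single b₀ 1 : Bond Λ → ℂ))) 0 =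
      (NormedSpace.exp (-(β • onSiteSum U μ (Finset.univ : Finset Λ)) + hopSum c) * bondOp b₀).trace := by
  rw [(hasDerivAt_Zc_add_smul_single β U μ c b₀ 0).deriv, zero_smul, add_zero, trace_mul_comm]

/-! ### The Hubbard Gibbs weight as a generalised Gibbs factor; the two-point function -/

variable (G : SimpleGraph Λ) [DecidableRel G.Adj]

/-- `e^{-β(H_G(t,U) - μN)} = exp(-βV_Λ + Σ_{b ∈ bonds G} βt T_b)` (the operator identity behind
`partitionFn_hamiltonianWith_eq_Zc`). [cite: Ueltschi1999, §3 (the Hubbard Hamiltonian H = V + T)] -/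
theorem gibbsWeight_hamiltonianWith_eq_exp (β t U μ : ℝ) :
    Matrix.gibbsWeight β (hamiltonianWith G t U μ) =
      NormedSpace.exp (-((β : ℂ) • onSiteSum (U : ℂ) (μ : ℂ) (Finset.univ : Finset Λ)) +
        hopSum (hubbardCoupling G ((β : ℂ) * (t : ℂ)))) := by
  unfold Matrix.gibbsWeight
  rw [hamiltonianWith_eq_hoppingForm_add_diagonal, hopSum_hubbardCoupling, onSiteSum_univ, smul_add, smul_smul,
    neg_mul_neg, neg_smul, add_comm]

/-- **The two-point function as a logarithmic derivative in the source**: on any finite graph,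
for real parameters,
`⟨c†_{xσ} c_{yσ}⟩_{β, H_G(t,U) - μN} = ∂_ε Zc(βt·1_{bonds G} + ε δ_{(x,y,σ)})|_{ε=0} / Zc(βt·1_{bonds G})`.
[cite: Ueltschi1999, proof of Thm. 2.1 (ii) (⟨K⟩ = Tr K e^{-βH_Λ} / Tr e^{-βH_Λ}, both expanded)] -/
theorem thermalCorr_creation_annihilation_eq_deriv_div (β t U μ : ℝ) (x y : Λ) (σ : Fin 2) :
    Matrix.thermalCorr β (hamiltonianWith G t U μ) (creation (orb x σ)) (annihilation (orb y σ)) =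
      deriv (fun ε : ℂ => Zc (β : ℂ) (U : ℂ) (μ : ℂ)
          (hubbardCoupling G ((β : ℂ) * (t : ℂ)) + ε • (Pi.single (x, y, σ) 1 : Bond Λ → ℂ))) 0 /
        Zc (β : ℂ) (U : ℂ) (μ : ℂ) (hubbardCoupling G ((β : ℂ) * (t : ℂ))) := by
  rw [Matrix.thermalCorr, Matrix.gibbsState_apply, partitionFn_hamiltonianWith_eq_Zc, deriv_Zc_add_smul_single_zero,
    ← gibbsWeight_hamiltonianWith_eq_exp, div_eq_inv_mul]
  rfl

end Source

/-! ### A differentiable logarithm of the source-inserted factor has derivative `⟨T_{b₀}⟩` at `0` -/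

section LogDeriv

/-- **Logarithmic derivative through any branch.** If `F` and `Z` are complex-differentiable at
`0`, `Z 0 ≠ 0`, and `exp(F ε) · κ = Z ε` for `ε` near `0` (a constant `κ ≠ 0`, e.g. the atomic
factor `z₀^{|Λ|}` relating `Zc` to the polymer partition function), then `F'(0) = Z'(0)/Z(0)`.
[folklore] -/
theorem deriv_eq_deriv_div_of_exp_mul_eq {F Z : ℂ → ℂ} {κ : ℂ} (hF : DifferentiableAt ℂ F 0)
    (hZ0 : Z 0 ≠ 0) (h : ∀ᶠ ε in 𝓝 (0 : ℂ), Complex.exp (F ε) * κ = Z ε) :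
    deriv F 0 = deriv Z 0 / Z 0 := by
  have hd : HasDerivAt (fun ε => Complex.exp (F ε) * κ) (Complex.exp (F 0) * deriv F 0 * κ) 0 :=
    ((Complex.hasDerivAt_exp (F 0)).comp 0 hF.hasDerivAt).mul_const κ
  have hZ : HasDerivAt Z (Complex.exp (F 0) * deriv F 0 * κ) 0 := hd.congr_of_eventuallyEq (by
    filter_upwards [h] with ε hε using hε.symm)
  have h0 : Complex.exp (F 0) * κ = Z 0 := h.self_of_nhds
  rw [hZ.deriv, ← h0]
  have hκ : κ ≠ 0 := by
    rintro rfl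
    rw [mul_zero] at h0
    exact hZ0 h0.symm
  field_simp [Complex.exp_ne_zero (F 0), hκ]

end LogDeriv

/-! ### The two-point function of `bgm_two_point_limit` -/

section Torus

/-- **The finite-volume two-point function of the fact `bgm_two_point_limit` as a logarithmic
derivative in the source**: for `L ≠ 0` and equal spins,
`⟨c†_{xσ} c_{yσ}⟩_{β,L} = ∂_ε Zc_L(β·1_{bonds} + ε δ_{(x̄,ȳ,σ)})|₀ / Zc_L(β·1_{bonds})` on the fermionic
torus `(ℤ/Lℤ)²` (`x̄, ȳ` the images of `x, y ∈ ℤ²`; hopping `t = 1`). (The unequal-spin components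
vanish identically, `hubbardThermalTwoPoint_eq_zero_of_ne` of `HubbardFermiLiquidProofs`.)
[cite: Ueltschi1999, proof of Thm. 2.1 (ii)] -/
theorem hubbardThermalTwoPoint_eq_deriv_div (β U μ : ℝ) (L : ℕ) [NeZero L] (x y : Site 2) (σ : Fin 2) :
    hubbardThermalTwoPoint β U μ L x y σ σ =
      deriv (fun ε : ℂ => Zc (β : ℂ) (U : ℂ) (μ : ℂ)
          (hubbardCoupling (fermionTorusGraph 2 L) (β : ℂ) +
            ε • (Pi.single (FermionTorus.ofTorusSite (Torus.proj L x), FermionTorus.ofTorusSite (Torus.proj L y), σ) 1 :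
              Bond (FermionTorus 2 L) → ℂ))) 0 /
        Zc (β : ℂ) (U : ℂ) (μ : ℂ) (hubbardCoupling (fermionTorusGraph 2 L) (β : ℂ)) := by
  have h := thermalCorr_creation_annihilation_eq_deriv_div (fermionTorusGraph 2 L) β 1 U μ
    (FermionTorus.ofTorusSite (Torus.proj L x)) (FermionTorus.ofTorusSite (Torus.proj L y)) σ
  rw [Complex.ofReal_one, mul_one] at h
  unfold hubbardThermalTwoPoint
  rw [dif_neg (NeZero.ne L)]
  -- `convert`, not `exact`: the `DecidableEq` instance terms synthesised inside the definition
  -- of `hubbardThermalTwoPoint` (and in `Pi.single` here) differ syntactically from those of the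
  -- general lemma (closed by `Subsingleton.elim`); `hubbardTorusWith` unfolds by `rfl`.
  convert h using 10
  all_goals try rfl

end Torus

end Literature.MathematicalPhysics.QuantumLattice

end
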